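import Literature.MathematicalPhysics.QuantumFieldTheory.Balaban1983to89.B9Eq326ClosingBetaWindow
import Literature.MathematicalPhysics.QuantumFieldTheory.Balaban1983to89.B9Eq3126QG1QClosingBetaWindow

/-!
# `Balaban1983to89.B9Eq3126ClosingRadiusWindow` — T. Bałaban, *Propagators for lattice gauge theories in a background field*, Commun. Math. Phys. **99** (1985)
# 389–434 [Balaban1985BackgroundPropagators] (3.26) p. 395, (3.49) p. 399, (3.126) p. 420, Thm 3.11 p. 416 with [Balaban1985Variational] (45) p. 285: **ONE RADIUS
# `r₀ > 0` BEFORE EVERY BACKGROUND — THE SIDE CONDITIONS OF ROAD ΔA-CT CLOSE FOR EVERY CONJUGATION RADIUS `0 ≤ r ≤ r₀` WHEN THE CONJUGATION LETTERS ARE LINEAR IN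
# `r`** (`β = N_β·r` from the radius windows and the `Q(U)` letters, `β_K = N_K·r` from the `Δ′` letter `B9Eq369CurvFormConjugation`, `ρ = 15βs_A∕√κ₁` from
# `B9Eq349ConjugatedProjectionDifferenceChain`, `C_P ≤ √(C_Q∕√κ₁)` from `B9Eq325ProjectionDivergenceQuarterKappa`): with
# `r₀ := min (1∕N_β) (min (√κ₁∕(120 s_A N_β)) (min ((γ∕4 − p_K∕2)∕(N_β N + N_K)) ((μ₁∕2)∕(N_β N₁ + N_K C_Q(C_Q+1)(4∕γ)²))))`, positive iff `p_K < γ∕2` (and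
# `μ₁ > 0`), EVERY `r ≤ r₀` gives `small`, `ρ ≤ 1∕8`, `12βs_A ≤ √κ₁` (`B9Eq326ClosingBetaWindow.closing_of_beta_le_beta0`) AND `small2`
# (`B9Eq3126QG1QClosingBetaWindow.small2_of_beta_le_beta1`) — the decay files of the road (`G₁`, `(QG₁Q*)⁻¹`, `H₁`, one step and tower) then hold at ONE rate
# `r₀` chosen from U-INDEPENDENT letters, i.e. `∃ r₀ > 0` BEFORE `∀ U` (and before the height, when the letters are height-free)

statement-level skeleton of published theorems with citation tags; proofs where landed; nothing here is a claim about the Yang–Mills mass gap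

CITATION HEADER (lean-in-tree rule).  Audit cell `pub-balaban`, sub-cell `t4`, BINDER row NE9 (road ΔA-CT of the NE9 formalisation swarm, leaf prover 03
`b2b-balaban-t4-ne9-formalise-leaf-03` gen 76).  Imports this lineage's (CBW) `B9Eq326ClosingBetaWindow` (t4-ne9-idea-1 g142 kernel D, CREDIT) and (QGW)
`B9Eq3126QG1QClosingBetaWindow` (idea-1 L-g142-4) — both Mathlib-only.  Sources READ first-hand: [Balaban1985BackgroundPropagators] p. 395 (3.26), p. 399 (3.49)
(print's rate `δ₀` NOT asserted — `r₀` is the cell's window size), p. 416 Thm 3.11, p. 420 (3.126); [Balaban1985Variational] p. 285 (45).  Pure real arithmetic.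

WHAT IS PROVED (sorry-free; proof lane — no `def`; [folklore] real arithmetic).
* `radius0_pos` (`p_K < γ∕2`, `μ₁ > 0`, `N_β > 0`, `N_K ≥ 0`, … ⟹ `0 < r₀`), `beta_le_beta0_of_r_le` ∕ `beta_le_beta1_of_r_le` (the two β-windows from `r ≤ r₀` at
  `β = N_βr`, `β_K = N_Kr`), **`closing_of_r_le_radius0`** (`0 ≤ r ≤ r₀`, `0 ≤ C_P`, `C_P² ≤ C_Q∕√κ₁` ⟹ `β ≤ 1 ∧ small ∧ ρ ≤ 1∕8 ∧ 12βs_A ≤ √κ₁ ∧ small2` at `β = N_βr`,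
  `β_K = N_Kr`, `ρ = 15(N_βr)s_A∕√κ₁`), **`exists_radius_closing`** (`∃ r₀ > 0, ∀ r ∈ [0, r₀], ∀ C_P …, the five conditions`).
HONEST SCOPE.  Abstract; every letter displayed (`γ, μ₁, p_K, a, C_Q, κ₁, s_A, N_β, N_K`); the linearity of `β, β_K` in `r` is the SUPPLIERS' (named above), not
proved here; no number; NOT NE9 (cell pub-balaban: NE9 NOT PRINTED ∕ NOT PROVED; «NE9 ⇐ the named binders»; row WALLED ON A MODEL (O-NE9-1; #5 UNRULED); spine PROVED
0∕9; rung (B)+1 on a finite T⁴ — NOT infinite volume, NOT mass gap, NOT BetaPertH, NOT Clay; HONEST DEPENDENCY: continuum YM on T⁴ ⇐ BetaPertH ∧ nine spine estimates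
(0/9 proved); BetaPertH ⇐ (D1) ∧ (D4) ∧ CAP+tail).  NEW file; nothing modified.  Net new unproved facts: 0.
-/

namespace Literature.MathematicalPhysics.QuantumFieldTheory.Balaban1983to89.B9Eq3126ClosingRadiusWindow

open B9Eq326ClosingBetaWindow (closing_of_beta_le_beta0)
open B9Eq3126QG1QClosingBetaWindow (small2_of_beta_le_beta1)

variable {γ a pK CQ κ₁ sA μ₁ Nβ NK : ℝ}

/-- **`r₀ > 0` EXACTLY WHEN THE `Δ′` FLOOR LEAVES ROOM**: `p_K < γ∕2`, `μ₁ > 0` (and the signs) ⟹ `0 < r₀`. [folklore]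
[cite: Balaban1985BackgroundPropagators, Thm 3.11 p.416, (3.126) p.420; Balaban1985Variational, (45) p.285] -/
theorem radius0_pos (hγ : 0 < γ) (ha : 0 ≤ a) (hCQ : 0 ≤ CQ) (hκ₁ : 0 < κ₁) (hsA : 0 < sA) (hμ₁ : 0 < μ₁) (hNβ : 0 < Nβ) (hNK : 0 ≤ NK)
    (hgap : pK < γ / 2) :
    0 < min (1 / Nβ) (min (Real.sqrt κ₁ / (120 * sA * Nβ))
      (min ((γ / 4 - pK / 2) / (Nβ * (4 * Real.sqrt (CQ / Real.sqrt κ₁) + 30 * sA * CQ / κ₁ + (21 + 3 * a)) + NK))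
        ((μ₁ / 2) / (Nβ * (4 / γ * (2 * CQ + 1) + CQ * (CQ + 1) *
          (4 / γ * (2 * (8 / γ) + (8 / γ + 4 / γ) + 2 * ((8 / γ + 4 / γ * Real.sqrt (CQ / Real.sqrt κ₁)) + 4 / γ) + a * CQ * (4 / γ) + a * (CQ + 1) * (4 / γ)) +
            15 * sA * ((8 / γ + 4 / γ * Real.sqrt (CQ / Real.sqrt κ₁)) * ((8 / γ + 4 / γ * Real.sqrt (CQ / Real.sqrt κ₁)) + 4 / γ)) / Real.sqrt κ₁)) +
          NK * (CQ * (CQ + 1) * (4 / γ) ^ 2))))) := by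
  have hsq : 0 < Real.sqrt κ₁ := Real.sqrt_pos.mpr hκ₁
  have hN : 0 < 4 * Real.sqrt (CQ / Real.sqrt κ₁) + 30 * sA * CQ / κ₁ + (21 + 3 * a) := by positivity
  have hN1 : 0 < 4 / γ * (2 * CQ + 1) + CQ * (CQ + 1) *
      (4 / γ * (2 * (8 / γ) + (8 / γ + 4 / γ) + 2 * ((8 / γ + 4 / γ * Real.sqrt (CQ / Real.sqrt κ₁)) + 4 / γ) + a * CQ * (4 / γ) + a * (CQ + 1) * (4 / γ)) +
        15 * sA * ((8 / γ + 4 / γ * Real.sqrt (CQ / Real.sqrt κ₁)) * ((8 / γ + 4 / γ * Real.sqrt (CQ / Real.sqrt κ₁)) + 4 / γ)) / Real.sqrt κ₁) := by positivity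
  refine lt_min (by positivity) (lt_min (by positivity) (lt_min ?_ ?_))
  · exact div_pos (by linarith) (by positivity)
  · exact div_pos (by linarith) (by positivity)

/-- from `r ≤ r₀`: CBW's window `β ≤ β₀` at `β = N_βr`, `β_K = N_Kr`. [folklore] [cite: Balaban1985BackgroundPropagators, (3.49) p.399, Thm 3.11 p.416] -/
theorem beta_le_beta0_of_r_le (ha : 0 ≤ a) (hCQ : 0 ≤ CQ) (hκ₁ : 0 < κ₁) (hsA : 0 < sA) (hNβ : 0 < Nβ) (hNK : 0 ≤ NK) {r : ℝ}
    (h1 : r ≤ 1 / Nβ) (h2 : r ≤ Real.sqrt κ₁ / (120 * sA * Nβ))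
    (h3 : r ≤ (γ / 4 - pK / 2) / (Nβ * (4 * Real.sqrt (CQ / Real.sqrt κ₁) + 30 * sA * CQ / κ₁ + (21 + 3 * a)) + NK)) :
    Nβ * r ≤ min 1 (min (Real.sqrt κ₁ / (120 * sA))
      ((γ / 4 - pK / 2 - NK * r) / (4 * Real.sqrt (CQ / Real.sqrt κ₁) + 30 * sA * CQ / κ₁ + (21 + 3 * a)))) := by
  have hsq : 0 < Real.sqrt κ₁ := Real.sqrt_pos.mpr hκ₁
  have hN : 0 < 4 * Real.sqrt (CQ / Real.sqrt κ₁) + 30 * sA * CQ / κ₁ + (21 + 3 * a) := by positivity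
  refine le_min ?_ (le_min ?_ ?_)
  · rw [le_div_iff₀ hNβ] at h1; linarith
  · rw [le_div_iff₀ (by positivity)] at h2
    rw [le_div_iff₀ (by positivity)]; linarith
  · rw [le_div_iff₀ (by positivity)] at h3
    rw [le_div_iff₀ hN]
    nlinarith

/-- from `r ≤ r₀`: QGW's window `β ≤ β₁` at `β = N_βr`, `β_K = N_Kr`, `P = √(C_Q∕√κ₁)`. [folklore] [cite: Balaban1985BackgroundPropagators, (3.126) p.420; Balaban1985Variational, (45) p.285] -/
theorem beta_le_beta1_of_r_le (hγ : 0 < γ) (ha : 0 ≤ a) (hCQ : 0 ≤ CQ) (hκ₁ : 0 < κ₁) (hsA : 0 < sA) (hNβ : 0 < Nβ) (hNK : 0 ≤ NK) {r : ℝ}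
    (h4 : r ≤ (μ₁ / 2) / (Nβ * (4 / γ * (2 * CQ + 1) + CQ * (CQ + 1) *
          (4 / γ * (2 * (8 / γ) + (8 / γ + 4 / γ) + 2 * ((8 / γ + 4 / γ * Real.sqrt (CQ / Real.sqrt κ₁)) + 4 / γ) + a * CQ * (4 / γ) + a * (CQ + 1) * (4 / γ)) +
            15 * sA * ((8 / γ + 4 / γ * Real.sqrt (CQ / Real.sqrt κ₁)) * ((8 / γ + 4 / γ * Real.sqrt (CQ / Real.sqrt κ₁)) + 4 / γ)) / Real.sqrt κ₁)) +
          NK * (CQ * (CQ + 1) * (4 / γ) ^ 2))) :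
    Nβ * r ≤ (μ₁ / 2 - NK * r * (CQ * (CQ + 1) * (4 / γ) ^ 2)) /
      (4 / γ * (2 * CQ + 1) + CQ * (CQ + 1) *
        (4 / γ * (2 * (8 / γ) + (8 / γ + 4 / γ) + 2 * ((8 / γ + 4 / γ * Real.sqrt (CQ / Real.sqrt κ₁)) + 4 / γ) + a * CQ * (4 / γ) + a * (CQ + 1) * (4 / γ)) +
          15 * sA * ((8 / γ + 4 / γ * Real.sqrt (CQ / Real.sqrt κ₁)) * ((8 / γ + 4 / γ * Real.sqrt (CQ / Real.sqrt κ₁)) + 4 / γ)) / Real.sqrt κ₁)) := by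
  have hsq : 0 < Real.sqrt κ₁ := Real.sqrt_pos.mpr hκ₁
  have hN1 : 0 < 4 / γ * (2 * CQ + 1) + CQ * (CQ + 1) *
      (4 / γ * (2 * (8 / γ) + (8 / γ + 4 / γ) + 2 * ((8 / γ + 4 / γ * Real.sqrt (CQ / Real.sqrt κ₁)) + 4 / γ) + a * CQ * (4 / γ) + a * (CQ + 1) * (4 / γ)) +
        15 * sA * ((8 / γ + 4 / γ * Real.sqrt (CQ / Real.sqrt κ₁)) * ((8 / γ + 4 / γ * Real.sqrt (CQ / Real.sqrt κ₁)) + 4 / γ)) / Real.sqrt κ₁) := by positivity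
  have hC : 0 ≤ CQ * (CQ + 1) * (4 / γ) ^ 2 := by positivity
  rw [le_div_iff₀ (by positivity)] at h4
  rw [le_div_iff₀ hN1]
  nlinarith

/-- **THE SIDE CONDITIONS AT EVERY RADIUS `r ≤ r₀`**: `β ≤ 1 ∧ small ∧ ρ ≤ 1∕8 ∧ 12βs_A ≤ √κ₁ ∧ small2` at `β = N_βr`, `β_K = N_Kr`, `ρ = 15(N_βr)s_A∕√κ₁`, for every
`C_P ∈ [0, √(C_Q∕√κ₁)]`. [folklore] [cite: Balaban1985BackgroundPropagators, (3.26) p.395, (3.49) p.399, (3.126) p.420, Thm 3.11 p.416; Balaban1985Variational, (45) p.285] -/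
theorem closing_of_r_le_radius0 (hγ : 0 < γ) (ha : 0 ≤ a) (hCQ : 0 ≤ CQ) (hκ₁ : 0 < κ₁) (hsA : 0 < sA) (hNβ : 0 < Nβ) (hNK : 0 ≤ NK)
    {r CP : ℝ} (hr : 0 ≤ r) (hCP : 0 ≤ CP) (hCP2 : CP ^ 2 ≤ CQ / Real.sqrt κ₁)
    (hr0 : r ≤ min (1 / Nβ) (min (Real.sqrt κ₁ / (120 * sA * Nβ))
      (min ((γ / 4 - pK / 2) / (Nβ * (4 * Real.sqrt (CQ / Real.sqrt κ₁) + 30 * sA * CQ / κ₁ + (21 + 3 * a)) + NK))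
        ((μ₁ / 2) / (Nβ * (4 / γ * (2 * CQ + 1) + CQ * (CQ + 1) *
          (4 / γ * (2 * (8 / γ) + (8 / γ + 4 / γ) + 2 * ((8 / γ + 4 / γ * Real.sqrt (CQ / Real.sqrt κ₁)) + 4 / γ) + a * CQ * (4 / γ) + a * (CQ + 1) * (4 / γ)) +
            15 * sA * ((8 / γ + 4 / γ * Real.sqrt (CQ / Real.sqrt κ₁)) * ((8 / γ + 4 / γ * Real.sqrt (CQ / Real.sqrt κ₁)) + 4 / γ)) / Real.sqrt κ₁)) +
          NK * (CQ * (CQ + 1) * (4 / γ) ^ 2)))))) :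
    Nβ * r ≤ 1 ∧
    (pK / 2 + (21 + 3 * a) * (Nβ * r) ^ 2 + 4 * (Nβ * r) * CP + 2 * (15 * ((Nβ * r) * sA) / Real.sqrt κ₁) * CP ^ 2 + NK * r ≤ γ / 4) ∧
    15 * ((Nβ * r) * sA) / Real.sqrt κ₁ ≤ 1 / 8 ∧ 12 * ((Nβ * r) * sA) ≤ Real.sqrt κ₁ ∧
    ((Nβ * r) * (4 / γ) * (2 * CQ + 1) + CQ * (CQ + 1) *
        ((Nβ * r) * (4 / γ * (2 * (8 / γ) + (8 / γ + 4 / γ) + 2 * ((8 / γ + 4 / γ * CP) + 4 / γ) + a * CQ * (4 / γ) + a * (CQ + 1) * (4 / γ))) +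
          (15 * ((Nβ * r) * sA) / Real.sqrt κ₁) * ((8 / γ + 4 / γ * CP) * ((8 / γ + 4 / γ * CP) + 4 / γ)) + (NK * r) * (4 / γ) ^ 2) ≤ μ₁ / 2) := by
  have h1 := hr0.trans (min_le_left _ _)
  have h2 := hr0.trans ((min_le_right _ _).trans (min_le_left _ _))
  have h3 := hr0.trans ((min_le_right _ _).trans ((min_le_right _ _).trans (min_le_left _ _)))
  have h4 := hr0.trans ((min_le_right _ _).trans ((min_le_right _ _).trans (min_le_right _ _)))
  have hβ : 0 ≤ Nβ * r := mul_nonneg hNβ.le hr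
  have hβ0 := beta_le_beta0_of_r_le (γ := γ) (pK := pK) ha hCQ hκ₁ hsA hNβ hNK h1 h2 h3
  have hβ1 := beta_le_beta1_of_r_le (μ₁ := μ₁) hγ ha hCQ hκ₁ hsA hNβ hNK h4
  obtain ⟨hsmall, hρ8, hwin⟩ := closing_of_beta_le_beta0 (βK := NK * r) (ρ := 15 * ((Nβ * r) * sA) / Real.sqrt κ₁) ha hCQ hκ₁ hsA hβ hCP hCP2 le_rfl hβ0
  have hρ0 : 0 ≤ 15 * ((Nβ * r) * sA) / Real.sqrt κ₁ := by positivity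
  have hCPP : CP ≤ Real.sqrt (CQ / Real.sqrt κ₁) := B9Eq326ClosingBetaWindow.CP_le_sqrt hCP hCP2
  have hsmall2 := small2_of_beta_le_beta1 (βK := NK * r) hγ ha hCQ hκ₁ hsA.le (Real.sqrt_nonneg _) hβ hCP hCPP hρ0 le_rfl hβ1
  exact ⟨hβ0.trans (min_le_left _ _), hsmall, hρ8, hwin, hsmall2⟩

/-- **ONE RADIUS BEFORE EVERY BACKGROUND**: `∃ r₀ > 0` such that every `r ∈ [0, r₀]` and every admissible `C_P` satisfy the five side conditions of the road at
`β = N_βr`, `β_K = N_Kr`, `ρ = 15(N_βr)s_A∕√κ₁` — the decay ENDS (`B9Eq326DeltaABlockDecay`, `B9Eq3126QG1QInvPointDecay`, `B9Eq3126H1BlockDecay` and their tower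
twins) then hold at the rate `r₀` for EVERY background supplying the letters linearly in `r`. [folklore]
[cite: Balaban1985BackgroundPropagators, (3.26) p.395, (3.49) p.399, (3.126) p.420, Thm 3.11 p.416; Balaban1985Variational, (45) p.285] -/
theorem exists_radius_closing (hγ : 0 < γ) (ha : 0 ≤ a) (hCQ : 0 ≤ CQ) (hκ₁ : 0 < κ₁) (hsA : 0 < sA) (hμ₁ : 0 < μ₁) (hNβ : 0 < Nβ) (hNK : 0 ≤ NK)
    (hgap : pK < γ / 2) :
    ∃ r₀ : ℝ, 0 < r₀ ∧ ∀ r CP : ℝ, 0 ≤ r → r ≤ r₀ → 0 ≤ CP → CP ^ 2 ≤ CQ / Real.sqrt κ₁ →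
      Nβ * r ≤ 1 ∧
      (pK / 2 + (21 + 3 * a) * (Nβ * r) ^ 2 + 4 * (Nβ * r) * CP + 2 * (15 * ((Nβ * r) * sA) / Real.sqrt κ₁) * CP ^ 2 + NK * r ≤ γ / 4) ∧
      15 * ((Nβ * r) * sA) / Real.sqrt κ₁ ≤ 1 / 8 ∧ 12 * ((Nβ * r) * sA) ≤ Real.sqrt κ₁ ∧
      ((Nβ * r) * (4 / γ) * (2 * CQ + 1) + CQ * (CQ + 1) *
          ((Nβ * r) * (4 / γ * (2 * (8 / γ) + (8 / γ + 4 / γ) + 2 * ((8 / γ + 4 / γ * CP) + 4 / γ) + a * CQ * (4 / γ) + a * (CQ + 1) * (4 / γ))) +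
            (15 * ((Nβ * r) * sA) / Real.sqrt κ₁) * ((8 / γ + 4 / γ * CP) * ((8 / γ + 4 / γ * CP) + 4 / γ)) + (NK * r) * (4 / γ) ^ 2) ≤ μ₁ / 2) :=
  ⟨_, radius0_pos hγ ha hCQ hκ₁ hsA hμ₁ hNβ hNK hgap, fun _ _ hr hr0 hCP hCP2 =>
    closing_of_r_le_radius0 hγ ha hCQ hκ₁ hsA hNβ hNK hr hCP hCP2 hr0⟩

end Literature.MathematicalPhysics.QuantumFieldTheory.Balaban1983to89.B9Eq3126ClosingRadiusWindow
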